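import Summits.CriticalPhenomena.PercolationContinuityZ3.Theorems.Transplant.SiteThetaContinuousRowsII
import Summits.CriticalPhenomena.PercolationContinuityZ3.Theorems.Transplant.Z3NetAmenable
import HarnessLib

/-!
# The SITE continuity column on covering lattices, III: the covering lattice of EVERY periodic bond structure on `ℤ³` with sign data

builds on p205010 (kernel theorem, internal audit signed; external expert review pending) — through `z3NetLineGraph_siteCriticalContinuity`
(gen 13, covering-graph device over gen 12's `Z3Net.SignData.criticalContinuity`).  Lane `prim-bschramm`, seat `prim-bschramm-p2` gen 17 (class
C1b); helper file (`--supports stmt-CriticalPhenomena-4575 --as helper`).  Continues `SiteThetaContinuousRowsII`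
(`continuous_siteTheta_lineGraph_of_polyGrowth`) with gen 15's cubic growth bound `Z3Net.SignData.ballVolume_le`.

* **`continuous_siteTheta_z3NetLineGraph (N : Z3Net) (S : N.SignData) (e)`** — `p ↦ θ^{site}_{L(N)}(e, p)` is continuous on `[0, 1]` at every
  site of the covering lattice of every net `N` on `ℤ³` carrying sign data (all rung-diluted cubic lattices, …): an ∀-family of site rows.
[cite: VandenBergKeane1984, main theorem] [cite: GrimmettPercolation1999, §8.3 Thm (8.8)] [cite: BenjaminiSchramm1996, Conj. 4] -/

noncomputable section

namespace Summit.CriticalPhenomena.PercolationContinuityZ3.Theorems.Transplant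

namespace SiteThetaContRows

open MeasureTheory Literature.Probability.Percolation Literature.Probability.LatticeModels SimpleGraph Filter
open Literature.Barriers.CriticalPhenomena
open scoped Classical Topology

/-- **`p ↦ θ^{site}(e, p)` is continuous on `[0, 1]` at every site of the covering lattice `L(N)` of every periodic bond structure `N` on `ℤ³`
with sign data** (cubic growth `|B_N(y,n)| ≤ (2R'+1)³(n+1)³` ⇒ `L(N)` amenable ⇒ site Burton–Keane; bounded degree ⇒ `p_c^{site} > 0`; van den
Berg–Keane; `θ^{site}(p_c^{site}) = 0` by `z3NetLineGraph_siteCriticalContinuity`). [cite: VandenBergKeane1984, main theorem] [cite: BenjaminiSchramm1996, Conj. 4] -/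
theorem continuous_siteTheta_z3NetLineGraph (N : Z3Net) (S : N.SignData) (e : N.graph.edgeSet) :
    Continuous fun p : unitInterval => siteTheta N.graph.lineGraph e p := by
  refine continuous_siteTheta_lineGraph_of_polyGrowth S.graph_connected S.graph_quasiTransitive
    (C := ((2 : ℝ) * (max 1 S.R : ℕ) + 1) ^ 3) (D := 3) (fun y n => ?_) e (z3NetLineGraph_siteCriticalContinuity N S e)
  have h1 : (ballVolume N.graph y n : ℝ) ≤ (2 * (n * (max 1 S.R : ℕ)) + 1 : ℝ) ^ 3 := by exact_mod_cast S.ballVolume_le y n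
  have hR : (1 : ℝ) ≤ (max 1 S.R : ℕ) := by exact_mod_cast le_max_left 1 S.R
  have hn : (0 : ℝ) ≤ n := Nat.cast_nonneg n
  have h2 : (2 * (n * (max 1 S.R : ℕ)) + 1 : ℝ) ≤ (2 * (max 1 S.R : ℕ) + 1) * ((n : ℝ) + 1) := by nlinarith
  have h3 : (2 * (n * (max 1 S.R : ℕ)) + 1 : ℝ) ^ 3 ≤ ((2 * (max 1 S.R : ℕ) + 1) * ((n : ℝ) + 1)) ^ 3 :=
    pow_le_pow_left₀ (by positivity) h2 3
  rw [mul_pow] at h3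
  exact h1.trans h3

end SiteThetaContRows

end Summit.CriticalPhenomena.PercolationContinuityZ3.Theorems.Transplant

end
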